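import Literature.Analysis.FluidPDE.DoeringFoiasProofs
import Literature.Analysis.FluidPDE.DoeringFoiasAmplitudeProofs
import HarnessLib

/-!
# Discharge of `doering_foias_bound` (turb.S05: the Doering–Foias bound `ε ≤ c₁U³/ℓ + c₂νU²/ℓ²`)

Trunk: FluidKinetic (`Literature/Analysis/FluidPDE`). The named fact
`Literature.Analysis.FluidPDE.doering_foias_bound` (`ZerothLaw`, turb.S05; Doering–Foias,
*Energy dissipation in body-forced turbulence*, J. Fluid Mech. 467 (2002), 289–306, abstract and
§§2–3: `ε ≤ c₁νU²/ℓ² + c₂U³/ℓ` with prefactors depending only on the shape of the body force;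
argument reproduced for weak solutions with `lim sup` averages in Cheskidov–Doering–Petrov,
J. Math. Phys. 48 (2007) 065208 = arXiv:physics/0607280, §II eq. (11) and §III eqs. (15)–(21),
`α = 0`) is now a theorem. `DoeringFoias` reduced it (`doering_foias_bound_of`, the chain
`ε ≤ ⟨f·u⟩ ≤ |F| U ≤ a U³/ℓ + b ν U²/ℓ²`, CDP eq. (20) with `α = 0`) to the regularity of the
rescaled force `F Φ(n • x)` and three a-priori facts, all four of which are discharged in the tree:

* `ForcingShape.force_regular_holds` (`ZerothLawProofs`): `F Φ(n • ·)` is smooth, divergence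
  free and mean zero for `0 < n` (chain rule through `x ↦ n • x`, Haar invariance);
* `DoeringFoias2002_dissipation_le_power_holds` (`DoeringFoiasProofs`): `ε ≤ ⟨f·u⟩` for
  Leray–Hopf solutions, from the energy inequality and `limsup` bookkeeping (CDP eq. (11) and the
  sentence following it);
* `DoeringFoias2002_power_le_holds` (`DoeringFoiasPowerProofs`): `⟨f·u⟩ ≤ |F| U` by
  Cauchy–Schwarz in space and time (CDP eq. (17), `α = 0`);
* `DoeringFoias2002_amplitude_le_holds` (`DoeringFoiasAmplitudeProofs`): `|F| ≤ a U²/ℓ + b νU/ℓ²`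
  with `a = ‖∑ᵢ‖∂ᵢΦ‖‖_∞ + 1`, `b = ‖ΔΦ‖_∞ + 1`, by testing the momentum equation against the
  multiplier `ψ = Φ(n • ·)` (CDP eqs. (18)–(19)).

Hence `doering_foias_bound_holds`, with constants `c₁ = a`, `c₂ = b` depending on `Φ` only, and
its dimensionless form `β = εℓ/U³ ≤ a + b Re⁻¹` (`doering_foias_dissipationCoeff_le`, from
`dissipationCoeff_le_of`). This file only assembles; it sits in a separate module because
`DoeringFoias` imports `ZerothLaw` and `DoeringFoiasPowerProofs` imports `ZerothLawProofs`, so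
neither the statement file nor its `…Proofs` sibling can import the three discharges. Axioms
`propext`, `Classical.choice`, `Quot.sound` only.

## References

* C. R. Doering, C. Foias, *Energy dissipation in body-forced turbulence*, J. Fluid Mech. 467
  (2002), 289–306, doi:10.1017/S0022112002001386, abstract and §§2–3. [DoeringFoias2002]
  (Paywalled, acquisition `acq-00001`; the statement is checked against the open follow-up below,
  which reproduces the `α = 0` argument verbatim.)
* A. Cheskidov, C. R. Doering, N. P. Petrov, *Energy dissipation in fractal-forced flow*, J. Math.
  Phys. 48 (2007) 065208, arXiv:physics/0607280, §II eqs. (7)–(11) (with "the relation in (11) is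
  only an inequality, i.e., `ε ≤ ⟨f·u⟩` … if the limit is replaced by `limsup_{T→∞}` … the
  estimates we derive are fully applicable to weak solutions"), §III eqs. (15)–(21)
  (`β ≤ Re^{α/(2-α)}(C₁ + C₂Re⁻¹)^{2/(2-α)}`, eq. (20); `α = 0`: `β ≤ C₁ + C₂Re⁻¹`).
  [CheskidovDoeringPetrov2006]
-/

noncomputable section

namespace Literature.Analysis.FluidPDE

/-- **The Doering–Foias bound, discharged** (turb.S05; Doering–Foias 2002, abstract and §§2–3:
`ε ≤ c₁νU²/ℓ² + c₂U³/ℓ` with shape-dependent prefactors; Cheskidov–Doering–Petrov 2007, §III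
eq. (20) with `α = 0`): the named fact `doering_foias_bound` holds — for every forcing shape `Φ`
on `T³` there are `c₁, c₂ > 0` (here `c₁ = ‖∑ᵢ‖∂ᵢΦ‖‖_∞ + 1`, `c₂ = ‖ΔΦ‖_∞ + 1`) such that every
global Leray–Hopf solution of the Navier–Stokes equations with viscosity `ν > 0` forced by
`F Φ(n • ·)`, `0 < n`, with `U = ⟨‖u‖₂²⟩^{1/2} > 0` obeys `ε = ⟨ν‖∇u‖₂²⟩ ≤ c₁U³/ℓ + c₂νU²/ℓ²`,
`ℓ = 1/n` (`limsup` averages, spectral gradients). Proof: `doering_foias_bound_of` fed with the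
four discharged inputs `ForcingShape.force_regular_holds`,
`DoeringFoias2002_dissipation_le_power_holds`, `DoeringFoias2002_power_le_holds`,
`DoeringFoias2002_amplitude_le_holds`. [cite: DoeringFoias2002, abstract and §§2–3 (ε ≤ c₁νU²/ℓ² + c₂U³/ℓ); CheskidovDoeringPetrov2006, §III eq. (20) (α = 0)] -/
theorem doering_foias_bound_holds : doering_foias_bound :=
  doering_foias_bound_of ForcingShape.force_regular_holds
    DoeringFoias2002_dissipation_le_power_holds DoeringFoias2002_power_le_holds
    DoeringFoias2002_amplitude_le_holds

/-- **Dimensionless form, discharged** (Cheskidov–Doering–Petrov 2007, §III eq. (20) with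
`α = 0`; Doering–Foias 2002, abstract: `β ≲ Re⁰` for square-integrable forcing): for every
forcing shape `Φ` on `T³` there are `a, b > 0` such that every global Leray–Hopf solution forced
by `F Φ(n • ·)` (`ν > 0`, `0 < n`) with `U > 0` has dissipation coefficient
`β = εℓ/U³ ≤ a + b Re⁻¹`, `Re = Uℓ/ν`, `ℓ = 1/n` — `dissipationCoeff_le_of` fed with the four
discharged inputs. [cite: CheskidovDoeringPetrov2006, §III eq. (20) (α = 0)] -/
theorem doering_foias_dissipationCoeff_le (Φ : ForcingShape (Fin 3)) :
    ∃ a b : ℝ, 0 < a ∧ 0 < b ∧ ∀ ⦃ν : ℝ⦄, 0 < ν → ∀ ⦃n : ℕ⦄, 0 < n →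
      ∀ (F : ℝ) (u₀ : UnitAddTorus (Fin 3) → EuclideanSpace ℝ (Fin 3))
        (u : ℝ → UnitAddTorus (Fin 3) → EuclideanSpace ℝ (Fin 3)),
        Torus.IsGlobalLerayHopf ν (fun _ => Φ.force n F) u₀ u →
        0 < rmsVelocity longTimeAvgSup u →
          dissipationCoeff (meanDissipation ν u) (n : ℝ)⁻¹ (rmsVelocity longTimeAvgSup u) ≤
            a + b * (reynoldsNumber (rmsVelocity longTimeAvgSup u) (n : ℝ)⁻¹ ν)⁻¹ :=
  dissipationCoeff_le_of ForcingShape.force_regular_holds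
    DoeringFoias2002_dissipation_le_power_holds DoeringFoias2002_power_le_holds
    DoeringFoias2002_amplitude_le_holds Φ

end Literature.Analysis.FluidPDE

end
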